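import Summits.Ventures.PercRepro.ProfileGapMonoColoopBandSucc
import Summits.Ventures.PercRepro.ProfileUnicyclicCircuitLoop

/-!
# PercRepro — THE MINIMAL GROUND SETS OF THE THRESHOLD FAMILY ARE THE BI-INDEPENDENT DENSITY (p5, gen 23;
`proofs/P5-GM1.md` §21(c); announced INBOX 11529)

On `#E = t + q` every rank-`(q−1)` set with a complement of rank `≥ t + 1` is a bi-independent `(q−1)`-set (its
complement an independent `(t+1)`-set), with demand exactly `t + 1`, and every co-rank-`t` rank-`q` set is a
bi-independent `q`-set; so `(I_t)` on `#E = t + q` reads `(t+1) · P_{q−1} ≤ q · P_q` — the bi-independent density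
non-increasing from `q − 1 = n − t − 1` to `q`, which is p10's Theorem A (`biIndepDensity_mono_of_fact`, modulo the
named fact `BiIndepDensityLogConcave`) when `2(q−1) + 2 ≤ n ⟺ q ≤ t`.  Hence `(★_q)` at the level `u = q + 1` on
the minimal ground set `#(E ∖ z) = 2q + 1`, and `(GM)_q` at a coloop there, modulo the same fact — the analogue of
p10's Corollary B′ for the coloop band case.  (At `t = q − 1` the base is free: `thresholdIneq_of_card_le`.)

* `thresholdSum_of_card_eq`, `levelSetCoQ_eq_biIndepSets_of_card_eq`, **`thresholdIneq_of_card_eq_of_fact`**,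
  **`starQ_succ_of_fact_of_card`**, `gapMonoQ_of_coloop_succ_of_fact_of_card`.
-/

open scoped Matroid

namespace PercRepro.Cogirth

open Finset ThmH Skew Shadow Profile

variable {α : Type} [DecidableEq α] {M : Matroid α} [M.Finite]

section Base

variable {N : Matroid α} [N.Finite] {q t : ℕ}

/-- On `#E = t + q` the threshold demand of a rank-`(q−1)` set is `t + 1` if it is bi-independent and `0`
otherwise. -/
theorem thresholdTerm_of_card_eq (hn : (gr N).card = t + q) (hq : 1 ≤ q) {B : Finset α}
    (hB : B ∈ Rq N (q - 1)) :
    (if t + 1 ≤ rk N (gr N \ B) then rk N (gr N \ B) else 0) =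
      if B ∈ biIndepSets N (q - 1) then t + 1 else 0 := by
  rw [mem_Rq] at hB
  obtain ⟨hBg, hBr⟩ := hB
  have hrkB : rk N B = q - 1 := rk_eq_of_eRk_eq hBr
  have h1 : rk N B ≤ B.card := rk_le_card _
  have h2 : rk N (gr N \ B) ≤ (gr N \ B).card := rk_le_card _
  have h3 : (gr N \ B).card = (gr N).card - B.card := card_sdiff_of_subset hBg
  have h4 : B.card ≤ (gr N).card := card_le_card hBg
  by_cases hbi : B ∈ biIndepSets N (q - 1)
  · rw [if_pos hbi]
    rw [mem_biIndepSets] at hbi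
    obtain ⟨_, hBk, _, hBc⟩ := hbi
    rw [hBc, h3, hBk, hn]
    rw [if_pos (by omega)]
    omega
  · rw [if_neg hbi]
    by_cases hle : t + 1 ≤ rk N (gr N \ B)
    · exfalso
      apply hbi
      rw [mem_biIndepSets]
      refine ⟨hBg, by omega, by omega, by omega⟩
    · rw [if_neg hle]

/-- On `#E = t + q` the threshold demand is `(t + 1) · P_{q−1}`. -/
theorem thresholdSum_of_card_eq (hn : (gr N).card = t + q) (hq : 1 ≤ q) :
    thresholdSum N q t = (t + 1) * (biIndepSets N (q - 1)).card := by
  unfold thresholdSum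
  rw [sum_congr rfl (fun B hB => thresholdTerm_of_card_eq hn hq hB), sum_ite_mem]
  have hsub : biIndepSets N (q - 1) ⊆ Rq N (q - 1) := by
    intro B hB
    rw [mem_biIndepSets] at hB
    obtain ⟨hBg, hBk, hBr, _⟩ := hB
    rw [mem_Rq]
    exact ⟨hBg, eRk_eq_of_rk_eq (by rw [hBr, hBk])⟩
  rw [inter_eq_right.2 hsub, sum_const, smul_eq_mul, Nat.mul_comm]

/-- On `#E = t + q` the co-rank-`t` rank-`q` sets are exactly the bi-independent `q`-sets. -/
theorem levelSetCoQ_eq_biIndepSets_of_card_eq (hn : (gr N).card = t + q) :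
    levelSetCoQ N t q = biIndepSets N q := by
  ext S
  rw [mem_levelSetCoQ, mem_biIndepSets]
  constructor
  · rintro ⟨⟨hSg, hSr⟩, hSc⟩
    have hrkS : rk N S = q := rk_eq_of_eRk_eq hSr
    have h1 : rk N S ≤ S.card := rk_le_card _
    have h2 : rk N (gr N \ S) ≤ (gr N \ S).card := rk_le_card _
    have h3 : (gr N \ S).card = (gr N).card - S.card := card_sdiff_of_subset hSg
    have h4 : S.card ≤ (gr N).card := card_le_card hSg
    refine ⟨hSg, by omega, by omega, by omega⟩
  · rintro ⟨hSg, hSk, hSr, hSc⟩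
    have h3 : (gr N \ S).card = (gr N).card - S.card := card_sdiff_of_subset hSg
    refine ⟨⟨hSg, eRk_eq_of_rk_eq (by rw [hSr, hSk])⟩, ?_⟩
    rw [hSc, h3, hSk, hn]
    omega

/-- **`(I_t)` on its minimal ground sets `#E = t + q`, modulo the named fact** (`1 ≤ q ≤ t`): the bi-independent
density is non-increasing from `q − 1` to `q` (p10's Theorem A at `2(q−1) + 2 ≤ #E`). -/
theorem thresholdIneq_of_card_eq_of_fact (hfact : BiIndepDensityLogConcave α) (hq : 1 ≤ q) (hqt : q ≤ t)
    (hn : (gr N).card = t + q) : ThresholdIneq N q t := by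
  unfold ThresholdIneq
  rw [thresholdSum_of_card_eq hn hq, levelSetCoQ_eq_biIndepSets_of_card_eq hn]
  have h := biIndepDensity_mono_of_fact hfact N (q - 1) (by omega)
  have e1 : (gr N).card - (q - 1) = t + 1 := by omega
  have e2 : q - 1 + 1 = q := by omega
  rw [e1, e2] at h
  exact h

end Base

section ColoopMinimal

variable {z : α} {q : ℕ}

/-- **`(★_q)` at the level `u = q + 1` on the minimal ground set `#(E ∖ z) = 2q + 1`, modulo the named fact**
(`1 ≤ q`). -/
theorem starQ_succ_of_fact_of_card (hfact : BiIndepDensityLogConcave α) (hq : 1 ≤ q)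
    (hn : (gr (M ＼ ({z} : Set α))).card = 2 * q + 1) : StarQ M z q (q + 1) :=
  (starQ_succ_iff_thresholdIneq hq).2
    (thresholdIneq_of_card_eq_of_fact hfact hq (by omega) (by rw [hn]; ring))

/-- **`(GM)_q` at a coloop at the level `u = q + 1` on `#E = 2q + 2`, modulo the named fact** (`1 ≤ q`): the row
`(q, q)` of `M ∖ z` is trivial and `(★_q)` there is Theorem A. -/
theorem gapMonoQ_of_coloop_succ_of_fact_of_card (hfact : BiIndepDensityLogConcave α) (hz : z ∈ gr M)
    (hzc : rk M ((gr M).erase z) + 1 = rk M (gr M)) (hq : 1 ≤ q) (hn : (gr M).card = 2 * q + 2) :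
    GapMonoQ M z q (q + 1) := by
  have hrow : ProfileIneqMinusQ (M ＼ ({z} : Set α)) q (q + 1 - 1) := by
    rw [Nat.add_sub_cancel]
    exact profileIneqMinusQ_self _ q
  have hn' : (gr (M ＼ ({z} : Set α))).card = 2 * q + 1 := by
    rw [gr_delete', card_erase_of_mem hz, hn]
    rfl
  exact gapMonoQ_of_coloop_of_starQ hz hzc hq (by omega) hrow (starQ_succ_of_fact_of_card hfact hq hn')

end ColoopMinimal

end PercRepro.Cogirth
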